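import Mathlib
import Summits.Ventures.PercRepro2.TypedBundleSeven
import Summits.Ventures.PercRepro2.TypedSepThreeTheorem

/-!
# The domain of record without the (SEP-3) classes (blind cell PercRepro2, p2 g6, 2026-08-25;
sub-claim S1 — p3 g6's typed (SEP-3) exact zero composed on the `|F| ≥ 7` layer; the lead's
R-SEP3 (a))

p3 g6's `SepThree.typedCount_eq_zero_of_hasSepThree` (TypedSepThreeTheorem.lean): if the doors
`a₁, a₃` separate `o` from `{a₂, b}` in the typed graph (`HasSepThree`), every typed base vanishes;
the mirror (doors `a₂, a₃`) by the root swap.  Composed in the `by_cases` pattern of every layer: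

* **`ResidualCoreNHatCTBRASUDO7S := ResidualCoreNHatCTBRASUDO7 ∧ ¬HasSepThree ∧ ¬HasSepThree(a₁ ↔ a₂)`**,
  **`HCov_all_of_residualCoreNHatCTBRASUDO7S_all`** — UNCONDITIONAL;
* the flat form **`FlatDomain7S_all`** (the twelve conditions of `FlatDomain7_all` and the two
  (SEP-3) conditions), **`HCov_all_of_flat7S_all`**.

Own code; standard axioms.
-/

namespace Summit.Ventures.PercRepro2

open UnionCluster

namespace CovForm

namespace TypedRed

section CoreSep

variable {V : Type*} {E : Type*} [DecidableEq V] [Fintype E] [DecidableEq E]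

/-- **The domain of record without the two (SEP-3) classes.** -/
structure ResidualCoreNHatCTBRASUDO7S (ends : E → Sym2 V) (o a₁ a₂ a₃ b : V) (F : Finset E) :
    Prop where
  coreNHatCTBRASUDO7 : ResidualCoreNHatCTBRASUDO7 ends o a₁ a₂ a₃ b F
  not_sepThree : ¬ SepThree.HasSepThree ends o a₁ a₂ a₃ b F
  not_sepThree_mirror : ¬ SepThree.HasSepThree ends o a₂ a₁ a₃ b F

end CoreSep

section ClosureSep

variable (R : Type*) [Field R] [LinearOrder R] [IsStrictOrderedRing R]

/-- **Row 2′TRI on `ResidualCoreNHatCTBRASUDO7S`, over every finite graph.** -/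
def ResidualCoreNHatCTBRASUDO7S_all : Prop :=
  ∀ (V E : Type) [Fintype V] [DecidableEq V] [Fintype E] [DecidableEq E]
    (ends : E → Sym2 V) (o a₁ a₂ a₃ b : V) (F : Finset E) (τ : E → ℕ),
    (∀ e ∈ F, τ e = 1 ∨ τ e = 2) → ResidualCoreNHatCTBRASUDO7S ends o a₁ a₂ a₃ b F →
      0 ≤ typedCount F (fun _ => false) τ
        (K3 ends o a₁ a₂ a₃ b : Config E → Config E → Config E → R)

/-- **THE CRUX OF RECORD FROM (TRI) ON THE DOMAIN WITHOUT THE (SEP-3) CLASSES** — unconditional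
(the tower, the rung `|F| = 6` and the two exact zeros). -/
theorem HCov_all_of_residualCoreNHatCTBRASUDO7S_all (hc : ResidualCoreNHatCTBRASUDO7S_all R) :
    HCov_all R := by
  refine HCov_all_of_residualCoreNHatCTBRASUDO7_all R ?_
  intro V E _ _ _ _ ends o a₁ a₂ a₃ b F τ hτ hdom
  by_cases hs : SepThree.HasSepThree ends o a₁ a₂ a₃ b F
  · exact le_of_eq (SepThree.typedCount_eq_zero_of_hasSepThree ends o a₁ a₂ a₃ b F τ hs).symm
  by_cases hm : SepThree.HasSepThree ends o a₂ a₁ a₃ b F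
  · exact le_of_eq (SepThree.typedCount_eq_zero_of_hasSepThree_mirror ends o a₁ a₂ a₃ b F τ hm).symm
  exact hc V E ends o a₁ a₂ a₃ b F τ hτ ⟨hdom, hs, hm⟩

/-- **Row 2′TRI on the flat domain without the (SEP-3) classes, over every finite graph.** -/
def FlatDomain7S_all : Prop :=
  ∀ (V E : Type) [Fintype V] [DecidableEq V] [Fintype E] [DecidableEq E]
    (ends : E → Sym2 V) (o a₁ a₂ a₃ b : V) (F : Finset E) (τ : E → ℕ),
    (∀ e ∈ F, τ e = 1 ∨ τ e = 2) →
    ResidualCore ends o a₁ a₂ a₃ b F →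
    ¬ Hats ends o a₁ a₂ a₃ b F →
    ¬ HasRootCut ends o a₁ a₂ a₃ b F →
    ¬ HasTwoTerminalPart ends o a₁ a₂ a₃ b F →
    ¬ HasRootBundle ends o a₁ a₂ a₃ b F →
    ¬ RootBridge.HasCutRoots ends o a₁ a₂ a₃ b F →
    ¬ RootBridge.HasCutRootsA3 ends o a₁ a₂ a₃ b F →
    ¬ OneStar ends o a₁ a₂ a₃ b F →
    ¬ RootBridge.MildInst ends o a₁ a₂ a₃ b F (fun _ => false) →
    o ≠ b →
    ¬ RootBridge.OBehindA3 ends o a₁ a₂ a₃ F (fun _ => false) →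
    7 ≤ F.card →
    ¬ SepThree.HasSepThree ends o a₁ a₂ a₃ b F →
    ¬ SepThree.HasSepThree ends o a₂ a₁ a₃ b F →
      0 ≤ typedCount F (fun _ => false) τ
        (K3 ends o a₁ a₂ a₃ b : Config E → Config E → Config E → R)

/-- **THE CRUX OF RECORD FROM (TRI) ON THE FLAT DOMAIN WITHOUT THE (SEP-3) CLASSES** — the
sentence of record in one statement, fourteen conditions. -/
theorem HCov_all_of_flat7S_all (hc : FlatDomain7S_all R) : HCov_all R := by
  refine HCov_all_of_residualCoreNHatCTBRASUDO7S_all R ?_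
  intro V E _ _ _ _ ends o a₁ a₂ a₃ b F τ hτ hdom
  obtain ⟨h0, h1, h2, h3, h4, h5, h6, h7, h8, h9, h10⟩ :=
    (ResidualCoreNHatCTBRASUDO_iff ends o a₁ a₂ a₃ b F).1 hdom.coreNHatCTBRASUDO7.coreNHatCTBRASUDO
  exact hc V E ends o a₁ a₂ a₃ b F τ hτ h0 h1 h2 h3 h4 h5 h6 h7 h8 h9 h10
    hdom.coreNHatCTBRASUDO7.seven_le hdom.not_sepThree hdom.not_sepThree_mirror

end ClosureSep

end TypedRed

end CovForm

end Summit.Ventures.PercRepro2
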